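import Summits.BirchSwinnertonDyer.BirchSwinnertonDyer.Theorems.PrintCFramBottomClassIndexLawFiveLeHerbrandBadPlacesSign
import Summits.BirchSwinnertonDyer.BirchSwinnertonDyer.Theorems.PrintCFramBottomClassIndexLawFiveLeHerbrandInertiaAtP
import Literature.NumberTheory.EllipticCurves.NeronOggShafarevichLocal
import Literature.NumberTheory.EllipticCurves.GeomPointsGaloisModule
import HarnessLib

/-!
# Route `PrintCFram`, crux C2 `BottomClassIndexLawFiveLe` (stmt-BirchSwinnertonDyer-20372), line
# `eisenstein-resource-bdp-line` (registry v18; LEAD g10 report §2(d), the LEVEL DICTIONARY (α)): **THE CLASS-SIDE LOCAL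
# INPUTS of the (α) consumer** — on the CM-ramified class, `W(K_v)[p] = 0` at every bad place `v ∤ p` of every number
# field `K`, and the inertia group of every prime of `\bar ℤ_K` above a bad place (resp. above `p`, over `ℚ`) has no
# non-zero fixed vector on a stable line `Φ ≤ W[p]` nor on its quotient `W[p]/Φ`
# (cell `bsd-print-cfram`, width seat `bsd-line-cfram-p1-w6` g3; helper `--supports` 20372; 0 defs, 0 facts, 0 sorry)

HONEST FRAMING. Nothing about BSD is proved here and no stub of the line is closed. These are the «class-side inputs, all
named» which w4 g8's (α) files (`…LevelDictionaryKummer`, `…LevelDictionaryLine`, `…LevelDictionaryPadic`) and (β) file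
(`…LevelDictionaryBeta`, hypotheses `hbad`, `hQI`) leave to the consumer `levelPos_imp_classFactor` (LEAD g10 report §4):
the hypotheses `hloc` (at the bad places prime to `p`) and `hQI` (at the bad places and at `p`) of
`LevelDictionary.unramified_quot_or_sub_of_kummer_line`, discharged for every member of the class (`W/ℚ` with CM, `p ≥ 5`
ramified in the CM field).

* §1 (generic, any number field `K`, any elliptic `W/K`, any `n ≠ 0`) `forall_nsmul_eq_zero_adicCompletion_of_mem_decomp`
  — **if some element of GreenbergSelmer's decomposition group `decomp v` fixes no non-zero `n`-torsion point of `W(K̄)`,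
  then `W(K_v)[n] = 0`** (`∀ P : W(K_v), n • P = 0 → P = 0`): an `n`-torsion point of `W(K_v)` read in `W(\bar K_v)` is
  `Γ_{K_v}`-fixed and algebraic (`exists_pointsMapOfEmb_eq_of_nsmul_eq_zero`, *AEC* III.6.4), and `decomp v` is the image of
  `Γ_{K_v}` (`pointsMap_smul`).
* §2 ON THE CLASS, any number field `K`, any bad place `v ∤ p` of `W_K`: **`forall_prime_nsmul_eq_zero_adicCompletion_of_bad`**
  (`W_K(K_v)[p] = 0`; the inertia element acting as `−1` on `W_K[p]` of w7 g0's
  `BadPlacesSign.exists_inertia_smul_eq_neg_of_cmRamified` lies in `decomp v` and fixes no non-zero `p`-torsion point, `p`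
  odd); `exists_mem_inertia_smul_eq_neg_of_bad` (the `−1` in the inertia group `I_𝔓 ≤ Γ_K` of EVERY prime `𝔓` of `\bar ℤ_K`
  above `v`, by transitivity `exists_smul_eq_of_mem_primesAbove_holds` and `conj_mem_inertia_smul`);
  **`quot_eq_zero_of_forall_inertia_smul_eq_of_bad`** / `sub_eq_zero_of_forall_inertia_smul_eq_of_bad` (no non-zero
  `I_𝔓`-fixed vector on `W_K[p]/Φ`, on `Φ`, for every `Γ_K`-stable `Φ ≤ W_K[p]`).
* §3 ON THE CLASS over `ℚ`, at the place `v ∋ p`: **`quot_eq_zero_of_forall_inertia_smul_eq_at_p`** (no non-zero `I_𝔓`-fixed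
  vector on `W[p]/Φ` for every stable `Φ` of order `p` and every `𝔓 ∣ p`: w4 g2's inertia homothety `c ≢ 1`,
  `BorelTorsion.exists_sq_mem_inertia_homothety`, and w4 g5's `HerbrandInertiaAtP.smul_ne_quot_of_homothety`);
  `exists_mem_decompositionSubgroup_ne_cyclotomic_at_p` (for a character `θ` of `Γ_ℚ` through which the inertia homothety
  `g` acts on `Φ` or on `W[p]/Φ`: `θ g ≠ χ̄_p g`, since `χ̄_p g = c²` and `θ g = c ≢ 1` — the `Γ_ℚ`-form input `H` of w4 g5's
  `HerbrandSelmerToHom.hdec_of_forall_primesAbove` for the EVEN engine).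
* §4 `hloc_of_bad_rat`, `hQI_rat` — the two hypotheses of `unramified_quot_or_sub_of_kummer_line` over `K = ℚ` at the places
  that are not (good and prime to `p`), except the level binder at `p` itself (w4 g8 `…LevelDictionaryPadic`).

THEOREMS ONLY; no definition, no named fact, no `sorry`. BSD is not proved by any of this; no summit statement is proved by
this seat. References: [SilvermanAEC2009] III.6.4, VII.4.1, VII.7.1, X.§4; [NeukirchANT1999] I §9 (9.1), (9.4), II (9.6);
[GrossLMS1991] §9; the LEAD g10 report §2(d) (crux workfile `Lines/eisenstein-resource-bdp-line-lead-g10.md`).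
-/

set_option autoImplicit false
-- `…BirchSwinnertonDyer.BirchSwinnertonDyer.Theorems…` is the problem's mandated namespace (D-0017).
set_option linter.dupNamespace false

noncomputable section

open scoped Classical Pointwise

namespace Summit.BirchSwinnertonDyer.BirchSwinnertonDyer.Theorems.PrintCFram.LevelDictionaryAlpha

open NumberField IsDedekindDomain Field WeierstrassCurve
open Literature.NumberTheory.EllipticCurves Literature.NumberTheory.GaloisRepresentations
  Literature.NumberTheory.EllipticCurves.GreenbergSelmer Literature.NumberTheory.EllipticCurves.Rank1Residual
open Summit.BirchSwinnertonDyer.Rank1Residual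

universe u

/-! ## §1 Generic: a decomposition element with no fixed `n`-torsion forces `W(K_v)[n] = 0` -/

section Generic

variable {K : Type u} [Field K] [NumberField K] (W : WeierstrassCurve K) [W.IsElliptic]

/-- **`W(K_v)[n] = 0` from one element of the decomposition group.** `K` a number field, `W/K` elliptic, `v` a finite place,
`n ≠ 0`. If some `δ ∈ decomp v` (the image of `Γ_{K_v}` in `Γ_K` for the tree's chosen embedding) fixes no non-zero point
`T ∈ W(K̄)` with `n • T = 0`, then `W(K_v)` has no non-zero `n`-torsion: such a point, read in `W(\bar K_v)`, is fixed by
`Γ_{K_v}` and is the image of an `n`-torsion point of `W(K̄)` (all `n`-torsion is algebraic, *AEC* III.6.4), on which `δ` acts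
through `pointsMap_smul`. [cite: SilvermanAEC2009, Cor. III.6.4(b) and X.§4] [cite: NeukirchANT1999, Ch. II §9 Prop. (9.6)] -/
theorem forall_nsmul_eq_zero_adicCompletion_of_mem_decomp (v : HeightOneSpectrum (𝓞 K)) {n : ℕ} (hn : n ≠ 0)
    {δ : absoluteGaloisGroup K} (hδ : δ ∈ decomp v)
    (hfix : ∀ T : W.geomPoints, n • T = 0 → δ • T = T → T = 0) :
    ∀ P : (W.baseChange (v.adicCompletion K)).toAffine.Point, n • P = 0 → P = 0 := by
  obtain ⟨σ, rfl⟩ := (mem_decomp_iff v δ).1 hδ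
  intro P hP
  set E := v.adicCompletion K with hE
  -- the point read in `W(\bar K_v)`, fixed by `Γ_{K_v}`
  set P' : localPoints W E :=
    (Affine.Point.map (W' := W) (IsScalarTower.toAlgHom K E (AlgebraicClosure E)) P : localPoints W E) with hP'
  have hP'fix : σ • P' = P' := by
    rw [hP', localPoints.smul_def]
    change Affine.Point.map _ (Affine.Point.map _ P) = Affine.Point.map _ P
    rw [Affine.Point.map_map]
    refine congrArg (fun f ↦ Affine.Point.map (W' := W) f P) ?_
    ext x
    exact AlgEquiv.commutes (show AlgebraicClosure E ≃ₐ[E] AlgebraicClosure E from σ) x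
  have hP'n : n • P' = 0 := by
    rw [hP']
    change n • Affine.Point.map (W' := W) (IsScalarTower.toAlgHom K E (AlgebraicClosure E)) P = 0
    rw [← map_nsmul, hP, map_zero]
  -- all `n`-torsion of `W(\bar K_v)` is algebraic
  obtain ⟨T, hTn, hT⟩ := exists_pointsMapOfEmb_eq_of_nsmul_eq_zero W (closureEmb (K := K) E) hn hP'n
  have hσT : absGaloisRestrict K E σ • T = T := by
    apply pointsMapOfEmb_injective W (closureEmb (K := K) E)
    have h1 : pointsMapOfEmb W (closureEmb (K := K) E) (resGal (K := K) E σ • T) = σ • P' := by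
      rw [← hT]; exact pointsMap_smul W E σ T
    rw [resGal_eq_absGaloisRestrict] at h1
    rw [h1, hP'fix, hT]
  have hT0 : T = 0 := hfix T hTn hσT
  have hP'0 : P' = 0 := by rw [← hT, hT0, map_zero]
  apply Affine.Point.map_injective (W' := W) (f := IsScalarTower.toAlgHom K E (AlgebraicClosure E))
  rw [map_zero]
  exact hP'0

omit [NumberField K] [W.IsElliptic] in
/-- **An element acting as `−1` on `W[p]` (`p` odd) fixes no non-zero `p`-torsion point of `W(K̄)`.** [folklore] -/
theorem eq_zero_of_smul_eq_of_smul_torsion_eq_neg {p : ℕ} [Fact p.Prime] (hp2 : p ≠ 2) {δ : absoluteGaloisGroup K}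
    (hδ : ∀ Q : W.geomTorsion (p : ℤ), δ • Q = -Q) (T : W.geomPoints) (hTn : p • T = 0) (hT : δ • T = T) : T = 0 := by
  have hmem : T ∈ W.geomTorsion (p : ℤ) := (mem_geomTorsion_iff W (p : ℤ) T).2 (by rw [natCast_zsmul, hTn])
  have hneg : δ • T = -T := by
    have h := congrArg ((↑) : W.geomTorsion (p : ℤ) → W.geomPoints) (hδ ⟨T, hmem⟩)
    rw [AddSubgroup.torsionBy.coe_smul, AddSubgroup.coe_neg] at h
    exact h
  refine BadPlacesInvisible.eq_zero_of_two_nsmul_of_prime_nsmul (p := p) hp2 ?_ hTn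
  rw [two_nsmul]
  nth_rw 1 [← hT]
  rw [hneg, neg_add_cancel]

end Generic

/-! ## §2 On the class: bad places prime to `p`, over any number field -/

section Bad

variable {K : Type} [Field K] [NumberField K] (W : WeierstrassCurve ℚ) [W.IsElliptic] {p : ℕ} [Fact p.Prime]

/-- **`W_K(K_v)[p] = 0` at every bad place `v ∤ p`, on the CM-ramified class.** For `W/ℚ` elliptic with CM, `p ≥ 5` ramified in the
CM field, ANY number field `K` and ANY finite place `v ∤ p` of `K` at which `W_K` has bad reduction: `W_K(K_v)` has no point of
order `p`. The inertia element of w7 g0's `BadPlacesSign.exists_inertia_smul_eq_neg_of_cmRamified` acts as `−1` on `W_K[p]`, lies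
in `decomp v`, and `p` is odd (§1). This is the hypothesis `hbad`/`htors` («`W(K_ℓ)[p] = 0` at bad `ℓ ≠ p`») of w4 g8's level
dictionary, discharged on the class. [cite: SilvermanAEC2009, Thm. VII.7.1 and Prop. VII.4.1] [cite: SilvermanATAEC1994, App. A §3] -/
theorem forall_prime_nsmul_eq_zero_adicCompletion_of_bad (hCM : W.HasCM) (hram : CMRamified W p) (h5 : 5 ≤ p)
    {v : HeightOneSpectrum (𝓞 K)} (hpv : ((p : ℕ) : 𝓞 K) ∉ v.asIdeal) (hbad : ¬ (W.baseChange K).HasGoodReductionAt v) :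
    ∀ P : ((W.baseChange K).baseChange (v.adicCompletion K)).toAffine.Point, p • P = 0 → P = 0 := by
  haveI : (W.baseChange K).IsElliptic := by unfold WeierstrassCurve.baseChange; infer_instance
  have hp2 : p ≠ 2 := by omega
  obtain ⟨σ, hσI, hσ⟩ := BadPlacesSign.exists_inertia_smul_eq_neg_of_cmRamified (K := K) (p := p) W hCM hram h5 hpv hbad
  exact forall_nsmul_eq_zero_adicCompletion_of_mem_decomp (W.baseChange K) v (Fact.out : p.Prime).ne_zero
    (inertia_le_decomp v hσI) (eq_zero_of_smul_eq_of_smul_torsion_eq_neg (W.baseChange K) hp2 hσ)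

/-- **The `−1` in EVERY inertia group above a bad place `v ∤ p`.** Same class, same `K`, `v`; for every prime `𝔓` of `\bar ℤ_K`
above `v` some `τ ∈ I_𝔓 ≤ Γ_K` acts as `−1` on `W_K[p]` (`inertia v = I_{𝔓₀}` for the chosen prime `𝔓₀`,
`inertia_adicCompletionPrime_eq_map_absInertia`; `Γ_K` is transitive on the primes above `v`; `g I_{𝔓₀} g⁻¹ ≤ I_{g𝔓₀}`).
[cite: NeukirchANT1999, Ch. I §9 Prop. (9.1) and (9.4)] [cite: SilvermanAEC2009, Thm. VII.7.1] -/
theorem exists_mem_inertia_smul_eq_neg_of_bad (hCM : W.HasCM) (hram : CMRamified W p) (h5 : 5 ≤ p)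
    {v : HeightOneSpectrum (𝓞 K)} (hpv : ((p : ℕ) : 𝓞 K) ∉ v.asIdeal) (hbad : ¬ (W.baseChange K).HasGoodReductionAt v)
    {𝔓 : Ideal (absIntegers (𝓞 K) K)} (h𝔓 : 𝔓 ∈ v.primesAbove) :
    ∃ τ ∈ 𝔓.inertia (absoluteGaloisGroup K), ∀ Q : (W.baseChange K).geomTorsion (p : ℤ), τ • Q = -Q := by
  haveI : (W.baseChange K).IsElliptic := by unfold WeierstrassCurve.baseChange; infer_instance
  obtain ⟨σ, hσI, hσ⟩ := BadPlacesSign.exists_inertia_smul_eq_neg_of_cmRamified (K := K) (p := p) W hCM hram h5 hpv hbad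
  have e : inertia (K := K) v = (adicCompletionPrime K v).inertia (absoluteGaloisGroup K) :=
    (inertia_adicCompletionPrime_eq_map_absInertia K v).symm
  rw [e] at hσI
  obtain ⟨g, hg⟩ := HeightOneSpectrum.exists_smul_eq_of_mem_primesAbove_holds (K := K) (v := v)
    (adicCompletionPrime_mem_primesAbove K v) h𝔓
  refine ⟨g * σ * g⁻¹, ?_, fun Q ↦ ?_⟩
  · rw [← hg]; exact BadPlacesSign.conj_mem_inertia_smul hσI
  · rw [mul_smul, mul_smul, hσ, smul_neg, smul_inv_smul]

variable (Φ : X2.ResidualDevissageModules.StableSubgroup (absoluteGaloisGroup K) ((W.baseChange K).geomTorsion (p : ℤ)))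

/-- **No non-zero `I_𝔓`-fixed vector on `W_K[p]/Φ` above a bad place `v ∤ p`** (any `Γ_K`-stable `Φ ≤ W_K[p]`): the hypothesis `hQI`
of `LevelDictionary.unramified_quot_or_sub_of_kummer_line` at the bad places prime to `p`, on the class.
[cite: SilvermanAEC2009, Thm. VII.7.1] [cite: NeukirchANT1999, Ch. I §9 (9.4)] -/
theorem quot_eq_zero_of_forall_inertia_smul_eq_of_bad (hCM : W.HasCM) (hram : CMRamified W p) (h5 : 5 ≤ p)
    {v : HeightOneSpectrum (𝓞 K)} (hpv : ((p : ℕ) : 𝓞 K) ∉ v.asIdeal) (hbad : ¬ (W.baseChange K).HasGoodReductionAt v)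
    {𝔓 : Ideal (absIntegers (𝓞 K) K)} (h𝔓 : 𝔓 ∈ v.primesAbove) (q : Φ.Quot)
    (hq : ∀ g ∈ 𝔓.inertia (absoluteGaloisGroup K), g • q = q) : q = 0 := by
  have hp2 : p ≠ 2 := by omega
  obtain ⟨τ, hτI, hτ⟩ := exists_mem_inertia_smul_eq_neg_of_bad (K := K) W hCM hram h5 hpv hbad h𝔓
  exact BadPlacesInvisible.noFixed_quot_of_smul_eq_neg (W.baseChange K) Φ hp2 hτ q (hq τ hτI)

/-- **No non-zero `I_𝔓`-fixed vector on `Φ` above a bad place `v ∤ p`** (companion of the previous theorem for the sub).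
[cite: SilvermanAEC2009, Thm. VII.7.1] [cite: NeukirchANT1999, Ch. I §9 (9.4)] -/
theorem sub_eq_zero_of_forall_inertia_smul_eq_of_bad (hCM : W.HasCM) (hram : CMRamified W p) (h5 : 5 ≤ p)
    {v : HeightOneSpectrum (𝓞 K)} (hpv : ((p : ℕ) : 𝓞 K) ∉ v.asIdeal) (hbad : ¬ (W.baseChange K).HasGoodReductionAt v)
    {𝔓 : Ideal (absIntegers (𝓞 K) K)} (h𝔓 : 𝔓 ∈ v.primesAbove) (x : Φ.Sub)
    (hx : ∀ g ∈ 𝔓.inertia (absoluteGaloisGroup K), g • x = x) : x = 0 := by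
  have hp2 : p ≠ 2 := by omega
  obtain ⟨τ, hτI, hτ⟩ := exists_mem_inertia_smul_eq_neg_of_bad (K := K) W hCM hram h5 hpv hbad h𝔓
  exact BadPlacesInvisible.noFixed_sub_of_smul_eq_neg (W.baseChange K) Φ hp2 hτ x (hx τ hτI)

end Bad

/-! ## §3 On the class over `ℚ`: the place above `p` -/

section AtP

variable (W : WeierstrassCurve ℚ) [W.IsElliptic] {p : ℕ} [hp : Fact p.Prime]
  (Φ : X2.ResidualDevissageModules.StableSubgroup (absoluteGaloisGroup ℚ) (W.geomTorsion (p : ℤ)))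

/-- **No non-zero `I_𝔓`-fixed vector on `W[p]/Φ` at every prime `𝔓 ∣ p` of `\bar ℤ`, on the CM-ramified class** (`Φ ≤ W[p]` a
`Γ_ℚ`-stable line of order `p`): some `g ∈ I_𝔓` acts on `W[p]` as a scalar `c ≢ 1 (mod p)` (w4 g2's
`BorelTorsion.exists_sq_mem_inertia_homothety`), and such a `g` moves every non-zero vector of the quotient
(`HerbrandInertiaAtP.smul_ne_quot_of_homothety`). The hypothesis `hQI` of `unramified_quot_or_sub_of_kummer_line` at `p`.
[cite: GrossLMS1991, §9] [cite: NeukirchANT1999, Ch. I §9 (9.4)–(9.6)] -/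
theorem quot_eq_zero_of_forall_inertia_smul_eq_at_p (hCM : W.HasCM) (h5 : 5 ≤ p) (hram : CMRamified W p)
    (hcard : Nat.card Φ.Sub = p) {v : HeightOneSpectrum (𝓞 ℚ)} (hv : ((p : ℕ) : 𝓞 ℚ) ∈ v.asIdeal)
    {𝔓 : Ideal (absIntegers (𝓞 ℚ) ℚ)} (h𝔓 : 𝔓 ∈ v.primesAbove) (q : Φ.Quot)
    (hq : ∀ g ∈ 𝔓.inertia (absoluteGaloisGroup ℚ), g • q = q) : q = 0 := by
  obtain ⟨g, hgI, -, c, hc, hg⟩ := BorelTorsion.exists_sq_mem_inertia_homothety (W := W) p hCM h5 hram hv h𝔓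
  by_contra hq0
  exact HerbrandInertiaAtP.smul_ne_quot_of_homothety W Φ hcard hc hg hq0 (hq g hgI)

/-- The same for the sub `Φ`. [cite: GrossLMS1991, §9] [cite: NeukirchANT1999, Ch. I §9 (9.4)–(9.6)] -/
theorem sub_eq_zero_of_forall_inertia_smul_eq_at_p (hCM : W.HasCM) (h5 : 5 ≤ p) (hram : CMRamified W p)
    (hcard : Nat.card Φ.Sub = p) {v : HeightOneSpectrum (𝓞 ℚ)} (hv : ((p : ℕ) : 𝓞 ℚ) ∈ v.asIdeal)
    {𝔓 : Ideal (absIntegers (𝓞 ℚ) ℚ)} (h𝔓 : 𝔓 ∈ v.primesAbove) (x : Φ.Sub)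
    (hx : ∀ g ∈ 𝔓.inertia (absoluteGaloisGroup ℚ), g • x = x) : x = 0 := by
  obtain ⟨g, hgI, -, c, hc, hg⟩ := BorelTorsion.exists_sq_mem_inertia_homothety (W := W) p hCM h5 hram hv h𝔓
  by_contra hx0
  exact HerbrandInertiaAtP.smul_ne_sub_of_homothety W Φ hcard hc hg hx0 (hx g hgI)

/-- **`θ g ≠ χ̄_p g` for the inertia homothety, for either character of the line.** If `Γ_ℚ` acts on `Φ` (resp. on `W[p]/Φ`)
through the character `θ` (`g • x = (θ g).val • x`), then at every prime `𝔓 ∣ p` of `\bar ℤ` some `g` in the DECOMPOSITION group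
`D_𝔓` has `θ g ≠ χ̄_p g`: for the inertia homothety `g = c` on `W[p]` one has `θ g = c` and `χ̄_p g = c · c` (the product of the two
line scalars is the cyclotomic character, here read off `Φ` and `W[p]/Φ` directly), and `c ≠ c²` as `c ≢ 1`. This is the input `H`
of w4 g5's `HerbrandSelmerToHom.hdec_of_forall_primesAbove` (the EVEN engine's `hdec`), for BOTH lines at once.
[cite: GrossLMS1991, §9] [cite: SilvermanCSS1997, Ch. II §7 Proposition (det ρ̄ = χ̄)] -/
theorem exists_mem_decompositionSubgroup_apply_ne_cyclotomic_at_p (hCM : W.HasCM) (h5 : 5 ≤ p) (hram : CMRamified W p)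
    (hcard : Nat.card Φ.Sub = p) (θS θQ : absoluteGaloisGroup ℚ →* (ZMod p)ˣ)
    (hθS : ∀ (g : absoluteGaloisGroup ℚ) (x : Φ.Sub), g • x = (((θS g : ZMod p).val : ℕ) : ℤ) • x)
    (hθQ : ∀ (g : absoluteGaloisGroup ℚ) (y : Φ.Quot), g • y = (((θQ g : ZMod p).val : ℕ) : ℤ) • y)
    (hprod : ∀ g : absoluteGaloisGroup ℚ, θS g * θQ g = modNCyclotomicCharacter ℚ p g)
    {v : HeightOneSpectrum (𝓞 ℚ)} (hv : ((p : ℕ) : 𝓞 ℚ) ∈ v.asIdeal)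
    {𝔓 : Ideal (absIntegers (𝓞 ℚ) ℚ)} (h𝔓 : 𝔓 ∈ v.primesAbove) :
    (∃ g ∈ 𝔓.decompositionSubgroup (absoluteGaloisGroup ℚ), θS g ≠ modNCyclotomicCharacter ℚ p g) ∧
      ∃ g ∈ 𝔓.decompositionSubgroup (absoluteGaloisGroup ℚ), θQ g ≠ modNCyclotomicCharacter ℚ p g := by
  obtain ⟨g, hgI, -, c, hc, hg⟩ := BorelTorsion.exists_sq_mem_inertia_homothety (W := W) p hCM h5 hram hv h𝔓
  have hgD : g ∈ 𝔓.decompositionSubgroup (absoluteGaloisGroup ℚ) := Ideal.inertia_le_decompositionSubgroup _ 𝔓 hgI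
  -- `θS g = c = θQ g`
  have hcardQ : Nat.card Φ.Quot = p := HerbrandLineRestriction.natCard_quot_eq_of_card_sub W Φ hcard
  haveI : Finite Φ.Sub := Nat.finite_of_card_ne_zero (by rw [hcard]; exact hp.out.ne_zero)
  haveI : Nontrivial Φ.Sub := Finite.one_lt_card_iff_nontrivial.mp (by rw [hcard]; exact hp.out.one_lt)
  haveI : Finite Φ.Quot := Nat.finite_of_card_ne_zero (by rw [hcardQ]; exact hp.out.ne_zero)
  haveI : Nontrivial Φ.Quot := Finite.one_lt_card_iff_nontrivial.mp (by rw [hcardQ]; exact hp.out.one_lt)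
  obtain ⟨x, hx⟩ := exists_ne (0 : Φ.Sub)
  obtain ⟨y, hy⟩ := exists_ne (0 : Φ.Quot)
  have hSx : g • x = c • x := Φ.incl_injective (by rw [Φ.incl_smul, map_zsmul, hg])
  obtain ⟨m, rfl⟩ := Φ.proj_surjective y
  have hQy : g • Φ.proj m = c • Φ.proj m := by rw [Φ.smul_proj, hg, map_zsmul]
  have hθSc : ((θS g : ZMod p) : ZMod p) = (c : ZMod p) := by
    have h := HerbrandLineRestriction.intCast_eq_of_zsmul_eq (p := p) hcard hx
      (a := (((θS g : ZMod p).val : ℕ) : ℤ)) (b := c) (by rw [← hθS g x, hSx])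
    rwa [Int.cast_natCast, ZMod.natCast_zmod_val] at h
  have hθQc : ((θQ g : ZMod p) : ZMod p) = (c : ZMod p) := by
    have h := HerbrandLineRestriction.intCast_eq_of_zsmul_eq (p := p) hcardQ hy
      (a := (((θQ g : ZMod p).val : ℕ) : ℤ)) (b := c) (by rw [← hθQ g (Φ.proj m), hQy])
    rwa [Int.cast_natCast, ZMod.natCast_zmod_val] at h
  -- `c ≠ 1` in `ZMod p`, hence `c ≠ c * c`
  have hc1 : (c : ZMod p) ≠ 1 := by
    intro h
    apply hc
    have h' : ((c - 1 : ℤ) : ZMod p) = 0 := by rw [Int.cast_sub, Int.cast_one, h, sub_self]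
    exact (ZMod.intCast_zmod_eq_zero_iff_dvd _ p).1 h'
  have hc0 : (c : ZMod p) ≠ 0 := by
    intro h
    have hu : ((θS g : ZMod p) : ZMod p) = 0 := by rw [hθSc, h]
    exact (θS g).ne_zero hu
  have hne : (c : ZMod p) ≠ (c : ZMod p) * (c : ZMod p) := by
    intro h
    apply hc1
    have h2 : (c : ZMod p) * 1 = (c : ZMod p) * (c : ZMod p) := by rw [mul_one]; exact h
    exact (mul_left_cancel₀ hc0 h2).symm
  have hχ : ((modNCyclotomicCharacter ℚ p g : (ZMod p)ˣ) : ZMod p) = (c : ZMod p) * (c : ZMod p) := by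
    rw [← hprod g, Units.val_mul, hθSc, hθQc]
  refine ⟨⟨g, hgD, fun h ↦ hne ?_⟩, ⟨g, hgD, fun h ↦ hne ?_⟩⟩
  · rw [← hχ, ← h, hθSc]
  · rw [← hχ, ← h, hθQc]

end AtP

end Summit.BirchSwinnertonDyer.BirchSwinnertonDyer.Theorems.PrintCFram.LevelDictionaryAlpha

end
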